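import Mathlib
import HarnessLib
import Summits.Ventures.LatticeQCDFlow.Exactness.ThermodynamicIntegration

/-!
# LinearFamilyStepMGF — the log-moment-generating function of ONE switch of the linear protocol,
# `Λ_{c,δ}(t) = F(c) − F(c+tδ) − t(F(c) − F(c+δ))` (`e^{Λ(t)} = E_{π_c}[(π_{c+δ}/π_c)^t]`, the Rényi
# divergence of order `t` times `t − 1`): convex, `Λ(0) = Λ(1) = 0`, `Λ'' = δ²·Var_{c+tδ}(D)`, hence
# `Λ(t) ≤ ½t(t−1)·δ²σ̄²` for `t ∉ (0,1)` and `Λ(t) ≤ 0` on `[0,1]`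

HONEST FRAMING: exact (Metropolis-corrected) sampling algorithms for lattice gauge theory;
figures of merit are autocorrelation/cost numbers at stated couplings and volumes; no
continuum-physics claim.

Venture `LatticeQCDFlow` (cell pub-lqcd), topic `Scaling`; FANOUT row 19 (`su2-snf`, GEN-6).
OUR WORK (one-variable calculus on row 8's thermodynamic integration
`Exactness/ThermodynamicIntegration`: `F' = ⟨D⟩_c`, `⟨D⟩_c' = −Var_c(D)`), nothing cited as a fact.
Purpose: the `t`-th exponential moment of the Jarzynski work of the `n`-step protocol factorises,
under PERFECT relaxation, into the one-step log-MGFs `Λ_{c_k,δ_k}(t)` (`Σ_k Λ_k(t) = log p_n^{(t)} +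
t·ΔF`, `Scaling/WorkExponentialMoments`, this seat); for general layers the tilted recursion of
`Scaling/TiltedProtocolRecursion` adds a lag.  This file is the perfect-relaxation input:

* `stepLogMGF S₀ D c δ t = F(c) − F(c+tδ) − t·(F(c) − F(c+δ))` (`F = linFreeEnergy`), with
  `stepLogMGF_zero`, `stepLogMGF_one` (`Λ(0) = Λ(1) = 0`: normalisation and Jarzynski),
  `exp_stepLogMGF` (`e^{Λ(t)} = [Z(c+tδ)/Z(c)]·e^{t(F(c+δ) − F(c))}`);
* `hasDerivAt_stepLogMGF` (`Λ'(t) = δ⟨D⟩_{c+tδ} − (F(c+δ) − F(c))`), `hasDerivAt_deriv_stepLogMGF`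
  (`Λ''(t) = δ²·Var_{c+tδ}(D) ≥ 0`), `convexOn_stepLogMGF`;
* **`stepLogMGF_le_of_varD_le`** — if `Var_c(D) ≤ σ̄²` for all `c` then for `t ≤ 0` or `1 ≤ t`:
  `Λ(t) ≤ ½·t(t−1)·δ²·σ̄²` (the function `Λ(t) − ½t(t−1)δ²σ̄²` is concave with zeros at `0, 1`);
  **`stepLogMGF_nonpos`** — `Λ(t) ≤ 0` for `t ∈ [0,1]` (convexity and the two zeros);
  `stepLogMGF_nonneg` — `0 ≤ Λ(t)` for `t ∉ (0,1)`;
* a scalar folding lemma used downstream: `exp_add_mul_le_exp_of_sq_le`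
  (`e^{a} + e^{c}y ≤ e^{a+3A/4}` for `c ≤ a`, `0 ≤ y`, `y² ≤ A²/2`).

Reading: these are the exact Gaussian-type bounds `log E e^{tℓ} ≤ ½t(t−1)·Var` for the one-step
log-weight `ℓ = log(π_{c+δ}/π_c)` with the variance taken at the WORST tilted member of the family —
no oscillation factor `e^{δΔD}` appears because the tilts stay inside the family.  NOT CLAIMED:
anything about layers (that is `WorkExponentialMoments`).
-/

namespace Summit.Ventures.LatticeQCDFlow.Scaling

open Set
open Summit.Ventures.LatticeQCDFlow.Exactness
open Summit.Ventures.LatticeQCDFlow.Theory2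

variable {X : Type*} [Fintype X] [Nonempty X]

/-- The one-step log-MGF `Λ_{c,δ}(t) = F(c) − F(c + tδ) − t·(F(c) − F(c + δ))`. -/
noncomputable def stepLogMGF (S₀ D : X → ℝ) (c δ t : ℝ) : ℝ :=
  linFreeEnergy S₀ D c - linFreeEnergy S₀ D (c + t * δ)
    - t * (linFreeEnergy S₀ D c - linFreeEnergy S₀ D (c + δ))

omit [Nonempty X] in
/-- `Λ(0) = 0` (normalisation). -/
@[simp] theorem stepLogMGF_zero (S₀ D : X → ℝ) (c δ : ℝ) : stepLogMGF S₀ D c δ 0 = 0 := by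
  simp [stepLogMGF]

omit [Nonempty X] in
/-- `Λ(1) = 0` (Jarzynski for one switch). -/
@[simp] theorem stepLogMGF_one (S₀ D : X → ℝ) (c δ : ℝ) : stepLogMGF S₀ D c δ 1 = 0 := by
  simp [stepLogMGF]

/-- `e^{Λ(t)} = [Z(c+tδ)/Z(c)]·e^{t(F(c+δ) − F(c))}`: the tilted reweighting factor of
`Scaling/LinearFamilyTilt` times the `t`-th power of the Jarzynski ratio `Z(c)/Z(c+δ)`. -/
theorem exp_stepLogMGF (S₀ D : X → ℝ) (c δ t : ℝ) :
    Real.exp (stepLogMGF S₀ D c δ t)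
      = partitionFn (linAction S₀ D (c + t * δ)) / partitionFn (linAction S₀ D c)
          * Real.exp (t * (linFreeEnergy S₀ D (c + δ) - linFreeEnergy S₀ D c)) := by
  have hZ := partitionFn_pos (linAction S₀ D c)
  have hZt := partitionFn_pos (linAction S₀ D (c + t * δ))
  unfold stepLogMGF
  rw [show linFreeEnergy S₀ D c - linFreeEnergy S₀ D (c + t * δ)
        - t * (linFreeEnergy S₀ D c - linFreeEnergy S₀ D (c + δ))
      = (linFreeEnergy S₀ D c - linFreeEnergy S₀ D (c + t * δ))
        + t * (linFreeEnergy S₀ D (c + δ) - linFreeEnergy S₀ D c) by ring, Real.exp_add]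
  congr 1
  unfold linFreeEnergy freeEnergy
  rw [show -Real.log (partitionFn (linAction S₀ D c)) - -Real.log (partitionFn (linAction S₀ D (c + t * δ)))
      = Real.log (partitionFn (linAction S₀ D (c + t * δ))) - Real.log (partitionFn (linAction S₀ D c))
      by ring, ← Real.log_div hZt.ne' hZ.ne', Real.exp_log (div_pos hZt hZ)]

/-- `Λ'(t) = δ·⟨D⟩_{c+tδ} − (F(c+δ) − F(c))`. -/
theorem hasDerivAt_stepLogMGF (S₀ D : X → ℝ) (c δ t : ℝ) :
    HasDerivAt (stepLogMGF S₀ D c δ)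
      (-(meanD S₀ D (c + t * δ) * δ) - (linFreeEnergy S₀ D c - linFreeEnergy S₀ D (c + δ))) t := by
  unfold stepLogMGF
  have hlin : HasDerivAt (fun t : ℝ => c + t * δ) δ t := by
    simpa using ((hasDerivAt_id t).mul_const δ).const_add c
  have hF := (hasDerivAt_linFreeEnergy S₀ D (c + t * δ)).comp t hlin
  have h1 := (hasDerivAt_const t (linFreeEnergy S₀ D c)).sub hF
  have h2 := (hasDerivAt_id t).mul_const (linFreeEnergy S₀ D c - linFreeEnergy S₀ D (c + δ))
  have h := h1.sub h2
  exact h.congr_deriv (by ring)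

/-- `Λ''(t) = δ²·Var_{c+tδ}(D)`. -/
theorem hasDerivAt_deriv_stepLogMGF (S₀ D : X → ℝ) (c δ t : ℝ) :
    HasDerivAt (deriv (stepLogMGF S₀ D c δ)) (δ ^ 2 * varD S₀ D (c + t * δ)) t := by
  have hderiv : deriv (stepLogMGF S₀ D c δ)
      = fun t => -(meanD S₀ D (c + t * δ) * δ)
          - (linFreeEnergy S₀ D c - linFreeEnergy S₀ D (c + δ)) :=
    funext fun t => (hasDerivAt_stepLogMGF S₀ D c δ t).deriv
  rw [hderiv]
  have hlin : HasDerivAt (fun t : ℝ => c + t * δ) δ t := by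
    simpa using ((hasDerivAt_id t).mul_const δ).const_add c
  have hm := (hasDerivAt_meanD S₀ D (c + t * δ)).comp t hlin
  have h := ((hm.mul_const δ).neg).sub (hasDerivAt_const t
    (linFreeEnergy S₀ D c - linFreeEnergy S₀ D (c + δ)))
  exact h.congr_deriv (by ring)

/-- `Λ` is differentiable. -/
theorem differentiable_stepLogMGF (S₀ D : X → ℝ) (c δ : ℝ) :
    Differentiable ℝ (stepLogMGF S₀ D c δ) :=
  fun t => (hasDerivAt_stepLogMGF S₀ D c δ t).differentiableAt

/-- `Λ'` is differentiable. -/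
theorem differentiable_deriv_stepLogMGF (S₀ D : X → ℝ) (c δ : ℝ) :
    Differentiable ℝ (deriv (stepLogMGF S₀ D c δ)) :=
  fun t => (hasDerivAt_deriv_stepLogMGF S₀ D c δ t).differentiableAt

/-- `Λ'' = δ²·Var_{c+tδ}(D)` as an iterated `deriv`. -/
theorem deriv2_stepLogMGF (S₀ D : X → ℝ) (c δ t : ℝ) :
    deriv^[2] (stepLogMGF S₀ D c δ) t = δ ^ 2 * varD S₀ D (c + t * δ) := by
  simp only [Function.iterate_succ, Function.iterate_zero, Function.comp_apply, Function.id_def]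
  exact (hasDerivAt_deriv_stepLogMGF S₀ D c δ t).deriv

/-- `Λ` is convex on `ℝ` (`Λ'' = δ²Var ≥ 0`). -/
theorem convexOn_stepLogMGF (S₀ D : X → ℝ) (c δ : ℝ) :
    ConvexOn ℝ univ (stepLogMGF S₀ D c δ) :=
  convexOn_univ_of_deriv2_nonneg (differentiable_stepLogMGF S₀ D c δ)
    (differentiable_deriv_stepLogMGF S₀ D c δ) fun t => by
      rw [deriv2_stepLogMGF]; exact mul_nonneg (sq_nonneg _) (varD_nonneg S₀ D _)

/-- **`Λ(t) ≤ 0` on `[0,1]`** (convexity and `Λ(0) = Λ(1) = 0`): the tilted one-step moments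
between the two Jarzynski normalisations are at most one. -/
theorem stepLogMGF_nonpos (S₀ D : X → ℝ) (c δ : ℝ) {t : ℝ} (h0 : 0 ≤ t) (h1 : t ≤ 1) :
    stepLogMGF S₀ D c δ t ≤ 0 := by
  have hconv := convexOn_stepLogMGF S₀ D c δ
  have h := hconv.2 (mem_univ (0:ℝ)) (mem_univ (1:ℝ)) (by linarith : 0 ≤ 1 - t) h0 (by ring)
  simp only [smul_eq_mul, mul_zero, mul_one, zero_add, stepLogMGF_zero, stepLogMGF_one,
    add_zero] at h
  exact h

/-- **`0 ≤ Λ(t)` outside `(0,1)`** (convexity again). -/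
theorem stepLogMGF_nonneg (S₀ D : X → ℝ) (c δ : ℝ) {t : ℝ} (ht : t ≤ 0 ∨ 1 ≤ t) :
    0 ≤ stepLogMGF S₀ D c δ t := by
  have hconv := convexOn_stepLogMGF S₀ D c δ
  rcases ht with ht | ht
  · -- 0 = (1/(1-t))•t-point… write 0 as a convex combination of t and 1
    rcases eq_or_lt_of_le ht with rfl | ht'
    · simp
    have hden : 0 < 1 - t := by linarith
    have h := hconv.2 (mem_univ t) (mem_univ (1:ℝ)) (div_nonneg zero_le_one hden.le)
      (div_nonneg (by linarith : 0 ≤ -t) hden.le) (by field_simp; ring)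
    have e : (1 / (1 - t)) • t + (-t / (1 - t)) • (1:ℝ) = 0 := by
      simp only [smul_eq_mul]; field_simp; ring
    rw [e, stepLogMGF_zero] at h
    simp only [smul_eq_mul, stepLogMGF_one, mul_zero, add_zero] at h
    have hpos : 0 < 1 / (1 - t) := by positivity
    by_contra hneg
    have := mul_neg_of_pos_of_neg hpos (lt_of_not_ge hneg)
    linarith
  · rcases eq_or_lt_of_le ht with rfl | ht'
    · simp
    have ht0 : 0 < t := by linarith
    -- 1 = (1 - 1/t)•0 + (1/t)•t
    have h := hconv.2 (mem_univ (0:ℝ)) (mem_univ t) (by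
        have : 1 / t ≤ 1 := by rw [div_le_one ht0]; exact ht
        linarith : 0 ≤ 1 - 1 / t)
      (div_nonneg zero_le_one ht0.le) (by ring)
    have e : (1 - 1 / t) • (0:ℝ) + (1 / t) • t = 1 := by
      simp only [smul_eq_mul, mul_zero, zero_add]; field_simp
    rw [e, stepLogMGF_one] at h
    simp only [smul_eq_mul, stepLogMGF_zero, mul_zero, zero_add] at h
    have hpos : 0 < 1 / t := by positivity
    by_contra hneg
    have := mul_neg_of_pos_of_neg hpos (lt_of_not_ge hneg)
    linarith

/-- **THE ONE-STEP GAUSSIAN-TYPE BOUND.**  If `Var_c(D) ≤ σ̄²` for every `c`, then for `t ≤ 0` or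
`1 ≤ t`: `Λ(t) ≤ ½·t(t−1)·δ²·σ̄²` (`Λ(t) − ½t(t−1)δ²σ̄²` is concave — second derivative
`δ²(Var_{c+tδ}(D) − σ̄²) ≤ 0` — and vanishes at `t = 0, 1`). -/
theorem stepLogMGF_le_of_varD_le (S₀ D : X → ℝ) (c δ : ℝ) {σbar : ℝ}
    (hσ : ∀ c', varD S₀ D c' ≤ σbar ^ 2) {t : ℝ} (ht : t ≤ 0 ∨ 1 ≤ t) :
    stepLogMGF S₀ D c δ t ≤ t * (t - 1) / 2 * (δ ^ 2 * σbar ^ 2) := by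
  set B := δ ^ 2 * σbar ^ 2 with hB
  set ψ : ℝ → ℝ := fun t => stepLogMGF S₀ D c δ t - t * (t - 1) / 2 * B with hψ
  have hq : ∀ t, HasDerivAt (fun t : ℝ => t * (t - 1) / 2 * B) ((2 * t - 1) / 2 * B) t := by
    intro t
    have h := (((hasDerivAt_id t).mul ((hasDerivAt_id t).sub_const 1)).div_const 2).mul_const B
    refine h.congr_deriv ?_
    simp only [id]; ring
  have hψ' : ∀ t, HasDerivAt ψ
      ((-(meanD S₀ D (c + t * δ) * δ) - (linFreeEnergy S₀ D c - linFreeEnergy S₀ D (c + δ)))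
        - (2 * t - 1) / 2 * B) t :=
    fun t => (hasDerivAt_stepLogMGF S₀ D c δ t).sub (hq t)
  have hdψ : deriv ψ = fun t =>
      (-(meanD S₀ D (c + t * δ) * δ) - (linFreeEnergy S₀ D c - linFreeEnergy S₀ D (c + δ)))
        - (2 * t - 1) / 2 * B := funext fun t => (hψ' t).deriv
  have hψ'' : ∀ t, HasDerivAt (deriv ψ) (δ ^ 2 * varD S₀ D (c + t * δ) - B) t := by
    intro t
    rw [hdψ]
    have hlin : HasDerivAt (fun t : ℝ => c + t * δ) δ t := by
      simpa using ((hasDerivAt_id t).mul_const δ).const_add c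
    have hm := (hasDerivAt_meanD S₀ D (c + t * δ)).comp t hlin
    have hl : HasDerivAt (fun t : ℝ => (2 * t - 1) / 2 * B) (2 / 2 * B) t := by
      have := ((((hasDerivAt_id t).const_mul 2).sub_const 1).div_const 2).mul_const B
      simpa using this
    have h := (((hm.mul_const δ).neg).sub (hasDerivAt_const t
      (linFreeEnergy S₀ D c - linFreeEnergy S₀ D (c + δ)))).sub hl
    exact h.congr_deriv (by ring)
  have hconc : ConcaveOn ℝ univ ψ := by
    refine concaveOn_univ_of_deriv2_nonpos (fun t => (hψ' t).differentiableAt)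
      (fun t => (hψ'' t).differentiableAt) fun t => ?_
    simp only [Function.iterate_succ, Function.iterate_zero, Function.comp_apply, Function.id_def]
    rw [(hψ'' t).deriv, hB]
    nlinarith [hσ (c + t * δ), sq_nonneg δ]
  have hψ0 : ψ 0 = 0 := by simp [hψ]
  have hψ1 : ψ 1 = 0 := by simp [hψ]
  -- concave with zeros at 0 and 1 ⇒ nonpositive outside (0,1)
  suffices hψt : ψ t ≤ 0 by
    have : stepLogMGF S₀ D c δ t - t * (t - 1) / 2 * B ≤ 0 := hψt
    linarith
  rcases ht with ht | ht
  · rcases eq_or_lt_of_le ht with rfl | ht'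
    · rw [hψ0]
    have hden : 0 < 1 - t := by linarith
    have h := hconc.2 (mem_univ t) (mem_univ (1:ℝ)) (div_nonneg zero_le_one hden.le)
      (div_nonneg (by linarith : 0 ≤ -t) hden.le) (by field_simp; ring)
    have e : (1 / (1 - t)) • t + (-t / (1 - t)) • (1:ℝ) = 0 := by
      simp only [smul_eq_mul]; field_simp; ring
    rw [e, hψ0] at h
    simp only [smul_eq_mul, hψ1, mul_zero, add_zero] at h
    have hpos : 0 < 1 / (1 - t) := by positivity
    by_contra hneg
    have := mul_pos hpos (lt_of_not_ge hneg)
    linarith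
  · rcases eq_or_lt_of_le ht with rfl | ht'
    · rw [hψ1]
    have ht0 : 0 < t := by linarith
    have h := hconc.2 (mem_univ (0:ℝ)) (mem_univ t) (by
        have : 1 / t ≤ 1 := by rw [div_le_one ht0]; exact ht
        linarith : 0 ≤ 1 - 1 / t)
      (div_nonneg zero_le_one ht0.le) (by ring)
    have e : (1 - 1 / t) • (0:ℝ) + (1 / t) • t = 1 := by
      simp only [smul_eq_mul, mul_zero, zero_add]; field_simp
    rw [e, hψ1] at h
    simp only [smul_eq_mul, hψ0, mul_zero, zero_add] at h
    have hpos : 0 < 1 / t := by positivity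
    by_contra hneg
    have := mul_pos hpos (lt_of_not_ge hneg)
    linarith

/-! ## A scalar folding lemma -/

/-- `e^{a} + e^{c}·y ≤ e^{a + 3A/4}` whenever `c ≤ a`, `0 ≤ y`, `y² ≤ A²/2` (`A ≥ 0`): `y ≤ 3A/4` and
`1 + 3A/4 ≤ e^{3A/4}`. -/
theorem exp_add_mul_le_exp_of_sq_le {a c y A : ℝ} (hca : c ≤ a) (hy : 0 ≤ y) (hA : 0 ≤ A)
    (hy2 : y ^ 2 ≤ A ^ 2 / 2) : Real.exp a + Real.exp c * y ≤ Real.exp (a + 3 * A / 4) := by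
  have hy' : y ≤ 3 * A / 4 := by
    have h : y ^ 2 ≤ (3 * A / 4) ^ 2 := hy2.trans (by nlinarith)
    exact (pow_le_pow_iff_left₀ hy (by linarith) two_ne_zero).mp h
  have hE1 : Real.exp c ≤ Real.exp a := Real.exp_le_exp.mpr hca
  have hE2 : 1 + 3 * A / 4 ≤ Real.exp (3 * A / 4) := by linarith [Real.add_one_le_exp (3 * A / 4)]
  have hpos := Real.exp_pos a
  calc Real.exp a + Real.exp c * y ≤ Real.exp a + Real.exp a * (3 * A / 4) := by
        nlinarith [mul_le_mul hE1 hy' hy hpos.le]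
    _ = Real.exp a * (1 + 3 * A / 4) := by ring
    _ ≤ Real.exp a * Real.exp (3 * A / 4) := mul_le_mul_of_nonneg_left hE2 hpos.le
    _ = Real.exp (a + 3 * A / 4) := by rw [← Real.exp_add]

end Summit.Ventures.LatticeQCDFlow.Scaling

/-! ## Sums of the one-step log-MGFs along a protocol grid (GEN-6 append)

The PERFECT-RELAXATION part of the work-MGF envelope: along a grid `c_0 ≤ c_1 ≤ … ≤ c_n` with
steps `δ_k = c_{k+1} − c_k ∈ [0, δ̄]` and `Var_c(D) ≤ σ̄²` for all `c`,
`Σ_{k<n} Λ_{c_k,δ_k}(t) ≤ ½[t(t−1)]₊·σ̄²·δ̄·(c_n − c_0)` (`sum_stepLogMGF_le_of_steps`; each term is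
`≤ ½t(t−1)δ_k²σ̄²` off `(0,1)` by `stepLogMGF_le_of_varD_le` and `≤ 0` on `[0,1]` by
`stepLogMGF_nonpos`, and `δ_k² ≤ δ̄·δ_k` telescopes); on the uniform grid `c_k = k/n`:
`Σ_{k<n} Λ_k(t) ≤ ½[t(t−1)]₊·σ̄²/n` (`sum_stepLogMGF_uniform_le`).  Under perfect relaxation
`Σ_k Λ_k(t) = log E_F[e^{−t(W−ΔF)}]`, so these ARE the MGF envelope in that case; the staged
`WorkExponentialMoments(AnyGrid)` add the layer lag. -/

namespace Summit.Ventures.LatticeQCDFlow.Scaling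

open Summit.Ventures.LatticeQCDFlow.Exactness
open Summit.Ventures.LatticeQCDFlow.Theory2

variable {X : Type*} [Fintype X] [Nonempty X]

/-- **The perfect part along a grid with steps `0 ≤ δ_k ≤ δ̄`**:
`Σ_{k<n} Λ_k(t) ≤ ½[t(t−1)]₊·σ̄²·δ̄·(c_n − c_0)`. -/
theorem sum_stepLogMGF_le_of_steps (t : ℝ) (S₀ D : X → ℝ) (c : ℕ → ℝ) (n : ℕ) {σbar δbar : ℝ}
    (hσ : ∀ c', varD S₀ D c' ≤ σbar ^ 2) (hmono : ∀ k, 0 ≤ c (k + 1) - c k)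
    (hstep : ∀ k, c (k + 1) - c k ≤ δbar) :
    ∑ k ∈ Finset.range n, stepLogMGF S₀ D (c k) (c (k + 1) - c k) t
      ≤ max (t * (t - 1)) 0 / 2 * σbar ^ 2 * δbar * (c n - c 0) := by
  have hkey : ∀ k ∈ Finset.range n,
      stepLogMGF S₀ D (c k) (c (k + 1) - c k) t
        ≤ max (t * (t - 1)) 0 / 2 * σbar ^ 2 * δbar * (c (k + 1) - c k) := by
    intro k _
    have hδ2 : (c (k + 1) - c k) ^ 2 ≤ δbar * (c (k + 1) - c k) := by
      rw [sq]; exact mul_le_mul_of_nonneg_right (hstep k) (hmono k)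
    have hout : (t ≤ 0 ∨ 1 ≤ t) →
        stepLogMGF S₀ D (c k) (c (k + 1) - c k) t
          ≤ max (t * (t - 1)) 0 / 2 * σbar ^ 2 * δbar * (c (k + 1) - c k) := by
      intro ht
      have h := stepLogMGF_le_of_varD_le S₀ D (c k) (c (k + 1) - c k) hσ ht
      refine h.trans ?_
      have htt : 0 ≤ t * (t - 1) := by
        rcases ht with ht | ht <;> nlinarith
      rw [max_eq_left htt]
      have : t * (t - 1) / 2 * ((c (k + 1) - c k) ^ 2 * σbar ^ 2)
          = t * (t - 1) / 2 * σbar ^ 2 * (c (k + 1) - c k) ^ 2 := by ring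
      rw [this]
      have hc0 : 0 ≤ t * (t - 1) / 2 * σbar ^ 2 := by positivity
      calc t * (t - 1) / 2 * σbar ^ 2 * (c (k + 1) - c k) ^ 2
          ≤ t * (t - 1) / 2 * σbar ^ 2 * (δbar * (c (k + 1) - c k)) :=
            mul_le_mul_of_nonneg_left hδ2 hc0
        _ = _ := by ring
    rcases le_or_gt t 0 with h0 | h0
    · exact hout (Or.inl h0)
    · rcases le_or_gt 1 t with h1 | h1
      · exact hout (Or.inr h1)
      · have h := stepLogMGF_nonpos S₀ D (c k) (c (k + 1) - c k) h0.le h1.le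
        refine h.trans ?_
        have hδbar0 : 0 ≤ δbar := (hmono k).trans (hstep k)
        have : 0 ≤ max (t * (t - 1)) 0 / 2 * σbar ^ 2 * δbar := by positivity
        exact mul_nonneg this (hmono k)
  calc ∑ k ∈ Finset.range n, stepLogMGF S₀ D (c k) (c (k + 1) - c k) t
      ≤ ∑ k ∈ Finset.range n, max (t * (t - 1)) 0 / 2 * σbar ^ 2 * δbar * (c (k + 1) - c k) :=
        Finset.sum_le_sum hkey
    _ = max (t * (t - 1)) 0 / 2 * σbar ^ 2 * δbar * (c n - c 0) := by
        rw [← Finset.mul_sum, Finset.sum_range_sub]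

/-- **The perfect part along the uniform grid `c_k = k/n`**: `Σ_{k<n} Λ_k(t) ≤ ½[t(t−1)]₊·σ̄²/n`. -/
theorem sum_stepLogMGF_uniform_le (t : ℝ) (S₀ D : X → ℝ) {n : ℕ} (hn : n ≠ 0) {σbar : ℝ}
    (hσ : ∀ c, varD S₀ D c ≤ σbar ^ 2) :
    ∑ k ∈ Finset.range n,
        stepLogMGF S₀ D ((k : ℝ) / n) ((((k + 1 : ℕ) : ℝ)) / n - (k : ℝ) / n) t
      ≤ max (t * (t - 1)) 0 / 2 * (σbar ^ 2 / n) := by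
  have hn' : (0 : ℝ) < n := Nat.cast_pos.mpr (Nat.pos_of_ne_zero hn)
  have hstepk : ∀ k : ℕ, ((k + 1 : ℕ) : ℝ) / n - (k : ℝ) / n = 1 / n := by
    intro k; rw [← sub_div]; push_cast; ring
  have h := sum_stepLogMGF_le_of_steps t S₀ D (fun k : ℕ => (k : ℝ) / n) n (δbar := 1 / n) hσ
    (fun k => by rw [hstepk k]; positivity) (fun k => (hstepk k).le)
  refine h.trans (le_of_eq ?_)
  rw [Nat.cast_zero, zero_div, sub_zero, div_self hn'.ne']
  ring

end Summit.Ventures.LatticeQCDFlow.Scaling
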